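import Literature.NumberTheory.Transcendental.Nesterenko2003Prop51Assembly
import Literature.NumberTheory.Transcendental.PhilipponZeroEstimateExact
import HarnessLib

/-!
# Nesterenko 2003, Prop. 5.1 at equal torus degrees `D₁ = ⋯ = Dₙ`

Topic `Literature/NumberTheory/Transcendental`. The case `D₁ = ⋯ = Dₙ` (`≥ 1`, `D₀ ≥ 1`) of the
named fact `Literature.NumberTheory.Transcendental.Nesterenko2003_prop51` (Nesterenko 2003, LNM 1819,
Prop. 5.1), PROVED from the exact zero estimate `GaGm.zero_estimate_exact_subgroup` (Z-a,
`PhilipponZeroEstimateExact.lean`) and the general-rank multiplicity bound in minors form (Z-b,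
`GaGmSliceMinors.lean`) through the assembly arithmetic `GaGm.nesterenko2003_prop51_of_data` with the
trivial isogeny (`k_j = 1`, `ι = 1`, `G* = H'`): `GaGm.nesterenko2003_prop51_equal_degrees`. This is
the end-to-end certificate of the Z-a/Z-b/Z-d chain; the general multidegree case only inserts the
isogeny package (Z-c) in place of the trivial data.

## References

* Yu. V. Nesterenko, *Linear forms in logarithms of rational numbers*, LNM 1819 (2003), §5.1,
  Prop. 5.1. [Nesterenko2003]
-/

noncomputable section

open Module Finset

namespace Literature.NumberTheory.Transcendental

namespace GaGm

variable {n : ℕ}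

/-- **Nesterenko's Prop. 5.1 at equal torus degrees** (`D₀ ≥ 1`, `D₁ = ⋯ = Dₙ = D₁ ≥ 1`): for a
non-zero `Q` with `deg_{Y₀} Q ≤ D₀`, `deg_{Y_j} Q ≤ 2D₁`, vanishing to order `> (n+1)S₀` along `𝔚` at
`Σ[n+1]` (`Σ ∋ e` finite), there is a connected algebraic subgroup `G* = 𝔙 × T_Φ` of dimension `≤ n`,
with a `ℤ`-basis `M` of `Φ`, such that
`binom(S₀+ℓ₀, ℓ₀) · Card((Σ·G*)/G*) · 𝓗(G*; D₀, D₁, …, D₁) ≤ (n+1)!·2ⁿ·D₀·D₁ⁿ`.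
[cite: Nesterenko2003, Prop 5.1] -/
theorem nesterenko2003_prop51_equal_degrees (D₀ S₀ D₁ : ℕ) (hD₀ : 1 ≤ D₀) (hD₁ : 1 ≤ D₁)
    (W : Submodule ℂ (ℂ × (Fin n → ℂ))) (S : Set (GaGm n)) (Q : MvPolynomial (Fin (n + 1)) ℂ)
    (hS : S.Finite) (h1 : (1 : GaGm n) ∈ S) (hQ : Q ≠ 0) (hdeg0 : Q.degreeOf 0 ≤ D₀)
    (hdeg : ∀ j : Fin n, Q.degreeOf j.succ ≤ 2 * D₁)
    (hvan : ∀ g ∈ sumset S (n + 1), VanishesToOrder Q W g ((n + 1) * S₀ + 1)) :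
    ∃ (H : ConnAlgSubgroup n) (r : ℕ) (M : Matrix (Fin r) (Fin n) ℤ),
      LinearIndependent ℤ (fun i => M i) ∧
      H.chars = AddSubgroup.closure (Set.range fun i => M i) ∧
      H.addDim + (n - r) ≤ n ∧
      Nat.choose (S₀ + (Module.finrank ℂ W - Module.finrank ℂ ↥(W ⊓ H.tangent)))
          (Module.finrank ℂ W - Module.finrank ℂ ↥(W ⊓ H.tangent)) *
        Set.ncard ((QuotientGroup.mk : GaGm n → GaGm n ⧸ H.toSubgroup) '' S) *
        nesterenkoH n r H.addDim M D₀ (fun _ => D₁) ≤ (n + 1).factorial * 2 ^ n * D₀ * ∏ _j : Fin n, D₁ := by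
  classical
  have hK : 1 ≤ 2 * D₁ := by omega
  have hQB : Q ∈ Box (n := n) D₀ (2 * D₁) 1 := by
    rw [mem_Box_iff, one_mul, one_mul]; exact ⟨hdeg0, hdeg⟩
  obtain ⟨H₀, hirr, hdim, -, hineq⟩ :=
    zero_estimate_exact_subgroup (T := S₀) W hD₀ hK hS h1 hQ hQB hvan
  obtain ⟨r, M, hli, hcl, -⟩ := exists_basis_charGroup H₀ hirr
  have hsub : (toConnAlgSubgroup H₀ hirr).toSubgroup = H₀ := toSubgroup_toConnAlgSubgroup H₀ hirr
  refine nesterenko2003_prop51_of_data D₀ S₀ (fun _ => D₁) hD₀ W S (2 * D₁) hK (fun _ => 1)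
    (fun _ => one_mul _) H₀ hirr (toConnAlgSubgroup H₀ hirr) r M M 1
    (Module.finrank ℂ W - Module.finrank ℂ ↥(W ⊓ (toConnAlgSubgroup H₀ hirr).tangent))
    hli (by rw [toConnAlgSubgroup_chars, hcl]) hli hcl rfl hdim rfl
    (fun I => by rw [Finset.prod_const_one, mul_one, one_mul]) ?_
  rw [mul_one, hsub]
  exact hineq

end GaGm

end Literature.NumberTheory.Transcendental
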